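import Literature.Geometry.Riemannian.HeatKernelStrongFeller
import Literature.Geometry.Riemannian.HeatKernelMeasurableData
import Literature.Geometry.Riemannian.MetricFlowPhiLipschitz
import Literature.Geometry.Riemannian.CutLocusProofs
import HarnessLib

/-!
# The gradient property of the heat kernel measures of a Ricci flow for bounded measurable data
# (Bamler 2023, Def. 3.2 (6), the case `T = 0`)

Item (6) of R. Bamler's definition of a metric flow (*Compactness theory of the space of super
Ricci flows*, Invent. Math. 233 (2023), Def. 3.2) with `T = 0` asks: for `s < t` and a measurable
`u : 𝒳_s → [0, 1]`, the function `x ↦ ∫ u dν_{x;s}` on `𝒳_t` is either constant or of the form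
`Φ ∘ f'` with `f'` `(t − s)^{-1/2}`-Lipschitz. This file proves it for the heat kernel measures
`ν_{x,t;s}` (`heatKernelMeasure`, `HeatKernelMeasures.lean`) of a `C^∞` family `h` of Riemannian
metrics on a closed CONNECTED manifold `M` (modelled on `ℝᵐ`) which is a Ricci flow on `[s, t]`
(`IsRicciFlow.integral_heatKernelMeasure_const_or_eq_Phi`), from Bamler's gradient estimate for
smooth data in `(0, 1)` (`HeatKernelGradientEstimate.lean`) by the following squeeze argument:

* for `r ∈ (s, t)` the function `U_r = ∫ u dν_{·,r;s}` is continuous with values in `[0, 1]`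
  (strong Feller property, `HeatKernelStrongFeller.lean`) and `∫ u dν_{x,t;s} = ∫ U_r dν_{x,t;r}`
  (reproduction formula, `HeatKernelMeasurableData.lean`); for `0 < ε < 1/2` the continuous datum
  `(1 − 2ε) U_r + ε ∈ [ε, 1 − ε]` has smooth uniform approximants with values in `(0, 1)`, whose
  propagations are `Φ ∘ (t − r)^{-1/2}`-Lipschitz functions (Thm. 4.1 with `T = 0` on `[r, t]`);
  letting the approximation go, then `r ↘ s`,
  `F_ε = Φ⁻¹ ∘ ((1 − 2ε) ∫ u dν_{·,t;s} + ε)` is `(t − s)^{-1/2}`-Lipschitz for every `ε`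
  (`IsRicciFlow.ofReal_abs_PhiInv_squeeze_sub_le`);
* if `0 < ∫ u dν_{x,t;s} < 1` everywhere, `ε → 0` gives the Lipschitz function
  `f' = Φ⁻¹ ∘ ∫ u dν_{·,t;s}`; if `∫ u dν_{x₀,t;s} = 0` for one `x₀` then `F_ε(x₀) = Φ⁻¹(ε) → −∞`
  drags `F_ε(x) ≤ F_ε(x₀) + (t − s)^{-1/2} d(x₀, x)` along (finite distance: `M` connected),
  forcing `∫ u dν_{x,t;s} = 0` for all `x` (`…integral_heatKernelMeasure_eq_zero_of_exists`); the
  value `1` is symmetric (`u ↦ 1 − u`).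

Everything is proved; no definitions, no named facts. Connectedness is necessary: on a
disconnected `M` the indicator of a component is propagated to itself.

## References

* R. H. Bamler, *Compactness theory of the space of super Ricci flows*, Invent. Math. 233 (2023),
  1121–1277, §3.1 Def. 3.2 (6); §3.7. [Bamler2023]
* R. H. Bamler, *Entropy and heat kernel bounds on a Ricci flow background*, arXiv:2008.07093
  (2020), Thm. 4.1. [Bamler2020Entropy]
-/

noncomputable section

open Bundle Set Function Filter Manifold MeasureTheory Measure TopologicalSpace
open scoped Manifold ContDiff Topology ENNReal NNReal

namespace Literature.Geometry.Riemannian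

open Lorentzian Lorentzian.PseudoRiemannianMetric MetricFlow

/-! ### Passing Lipschitz bounds in extended form to limits -/

/-- **Lipschitz bounds pass to pointwise limits**: if `ofReal |F n − G n| ≤ ofReal (L n) · d` for
all `n`, `F n → a`, `G n → b`, `L n → L₀ > 0`, then `ofReal |a − b| ≤ ofReal L₀ · d`
(`d ∈ ℝ≥0∞`; for `d = ∞` there is nothing to prove). [folklore] -/
theorem ofReal_abs_sub_le_of_tendsto {F G L : ℕ → ℝ} {a b L₀ : ℝ} {d : ℝ≥0∞}
    (hF : Tendsto F atTop (𝓝 a)) (hG : Tendsto G atTop (𝓝 b)) (hL : Tendsto L atTop (𝓝 L₀))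
    (hL₀ : 0 < L₀) (h : ∀ n, ENNReal.ofReal |F n - G n| ≤ ENNReal.ofReal (L n) * d) :
    ENNReal.ofReal |a - b| ≤ ENNReal.ofReal L₀ * d := by
  rcases eq_or_ne d ⊤ with hd | hd
  · rw [hd, ENNReal.mul_top (by simpa using hL₀)]
    exact le_top
  have hreal : ∀ n, |F n - G n| ≤ max (L n * d.toReal) 0 := by
    intro n
    have h1 := h n
    rw [← ENNReal.ofReal_toReal hd, ← ENNReal.ofReal_mul' ENNReal.toReal_nonneg,
      ENNReal.ofReal_le_ofReal_iff'] at h1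
    rcases h1 with h1 | h1
    · exact h1.trans (le_max_left _ _)
    · exact h1.trans (le_max_right _ _)
  have hlim : Tendsto (fun n ↦ max (L n * d.toReal) 0) atTop (𝓝 (max (L₀ * d.toReal) 0)) :=
    (hL.mul_const _).max tendsto_const_nhds
  have hle : |a - b| ≤ max (L₀ * d.toReal) 0 :=
    le_of_tendsto_of_tendsto' ((hF.sub hG).abs) hlim hreal
  rw [max_eq_left (mul_nonneg hL₀.le ENNReal.toReal_nonneg)] at hle
  calc ENNReal.ofReal |a - b| ≤ ENNReal.ofReal (L₀ * d.toReal) := ENNReal.ofReal_le_ofReal hle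
    _ = ENNReal.ofReal L₀ * d := by
      rw [ENNReal.ofReal_mul' ENNReal.toReal_nonneg, ENNReal.ofReal_toReal hd]

/-- `1/(n + c) → 0` as `n → ∞`. [folklore] -/
theorem tendsto_one_div_natCast_add (c : ℝ) :
    Tendsto (fun n : ℕ ↦ 1 / ((n : ℝ) + c)) atTop (𝓝 0) := by
  have h1 : Tendsto (fun n : ℕ ↦ (n : ℝ) + c) atTop atTop :=
    tendsto_natCast_atTop_atTop.atTop_add tendsto_const_nhds
  simpa [one_div, Function.comp_def] using tendsto_inv_atTop_zero.comp h1

/-- The sequence `ε_n = 1/(n + 4)` lies in `(0, 1/4]`. [folklore] -/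
theorem one_div_natCast_add_four_mem (n : ℕ) :
    (1 : ℝ) / ((n : ℝ) + 4) ∈ Ioo (0 : ℝ) (1 / 2) ∧ (1 : ℝ) / ((n : ℝ) + 4) ≤ 1 / 4 := by
  have hle : (1 : ℝ) / ((n : ℝ) + 4) ≤ 1 / 4 :=
    div_le_div_of_nonneg_left zero_le_one (by norm_num) (by linarith [n.cast_nonneg (α := ℝ)])
  exact ⟨⟨by positivity, by linarith⟩, hle⟩

section GradientZero

variable {m : ℕ} {H : Type*} [TopologicalSpace H]
  {I : ModelWithCorners ℝ (EuclideanSpace ℝ (Fin m)) H} [I.Boundaryless]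
  {M : Type*} [TopologicalSpace M] [ChartedSpace H M] [IsManifold I ∞ M]
  [T2Space M] [CompactSpace M] [SecondCountableTopology M] [MeasurableSpace M] [BorelSpace M]
  {h : ℝ → PseudoRiemannianMetric I ∞ (EuclideanSpace ℝ (Fin m)) (TangentSpace I : M → Type _)}
  (hh : IsContMDiffFamilyOn ∞ h univ) (hR : ∀ r, (h r).IsRiemannian)

/-! ### Step 1: the squeezed propagations are Lipschitz at a fixed intermediate time -/

/-- **The squeeze at an intermediate time.** Let `h` be a Ricci flow on `[s, t]`, `u : M → [0, 1]`
measurable, `U = ∫ u dν_{·,t;s}` and `0 < ε < 1/2`. For every `r ∈ (s, t)` the function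
`F_ε = Φ⁻¹ ∘ ((1 − 2ε) U + ε)` satisfies `|F_ε x − F_ε y| ≤ (t − r)^{-1/2} d_{h(t)}(x, y)`:
`U = ∫ U_r dν_{·,t;r}` with `U_r = ∫ u dν_{·,r;s}` continuous in `[0, 1]`, the continuous datum
`(1 − 2ε) U_r + ε` is a uniform limit of smooth data with values in `(0, 1)`, to whose propagations
Bamler's Thm. 4.1 (`T = 0`, on `[r, t]`) applies. [cite: Bamler2023, §3.1, Def. 3.2 (6)] -/
theorem IsRicciFlow.ofReal_abs_PhiInv_squeeze_sub_le_of_mem_Ioo {s t : ℝ}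
    {cov : ℝ → CovariantDerivative I (EuclideanSpace ℝ (Fin m)) (TangentSpace I : M → Type _)}
    (hflow : IsRicciFlow h cov (Icc s t))
    {u : M → ℝ} (hum : Measurable u) (hu01 : ∀ y, u y ∈ Icc (0 : ℝ) 1)
    {ε : ℝ} (hε : ε ∈ Ioo (0 : ℝ) (1 / 2)) {r : ℝ} (hr : r ∈ Ioo s t) (x y : M) :
    ENNReal.ofReal |PhiInv ((1 - 2 * ε) * ∫ z, u z ∂(heatKernelMeasure hh hR t x s) + ε) -
        PhiInv ((1 - 2 * ε) * ∫ z, u z ∂(heatKernelMeasure hh hR t y s) + ε)| ≤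
      ENNReal.ofReal (1 / Real.sqrt (t - r)) * (h t).edist (hR t) x y := by
  have hub : ∀ z, |u z| ≤ 1 := fun z ↦ abs_le.2 ⟨by linarith [(hu01 z).1], (hu01 z).2⟩
  have htr : 0 < t - r := sub_pos.2 hr.2
  -- `U_r` and its properties
  set Ur : M → ℝ := fun z ↦ ∫ w, u w ∂(heatKernelMeasure hh hR r z s) with hUr
  have hUrc : Continuous Ur :=
    (hflow.mono (Icc_subset_Icc le_rfl hr.2.le)).continuous_integral_heatKernelMeasure_of_measurable
      hh hR hr.1 hum hub ⟨hr.1, le_rfl⟩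
  have hUr01 : ∀ z, Ur z ∈ Icc (0 : ℝ) 1 := fun z ↦
    integral_heatKernelMeasure_mem_Icc_of_bounded hh hR r z s hum (fun w ↦ (hu01 w).1)
      (fun w ↦ (hu01 w).2)
  -- reproduction: `U = ∫ U_r dν_{·,t;r}`
  have hrep : ∀ z, ∫ w, u w ∂(heatKernelMeasure hh hR t z s) =
      ∫ w, Ur w ∂(heatKernelMeasure hh hR t z r) := fun z ↦
    integral_heatKernelMeasure_trans_of_bounded hh hR hr.1.le hr.2.le z hum hub
  -- the squeezed continuous datum `ψ = (1 - 2ε) U_r + ε ∈ [ε, 1 - ε]`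
  set ψ : M → ℝ := fun z ↦ (1 - 2 * ε) * Ur z + ε with hψ
  have hψc : Continuous ψ := (continuous_const.mul hUrc).add continuous_const
  have hε2 : 0 < 1 - 2 * ε := by linarith [hε.2]
  have hψb : ∀ z, ψ z ∈ Icc ε (1 - ε) := fun z ↦ by
    have h0 := (hUr01 z).1
    have h1 := (hUr01 z).2
    constructor
    · show ε ≤ (1 - 2 * ε) * Ur z + ε
      nlinarith
    · show (1 - 2 * ε) * Ur z + ε ≤ 1 - ε
      nlinarith
  have hψi : ∀ z, Integrable ψ (heatKernelMeasure hh hR t z r) := fun z ↦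
    hψc.integrable_of_hasCompactSupport (HasCompactSupport.of_compactSpace ψ)
  -- its propagation is the squeezed `U`
  have hPψ : ∀ z, ∫ w, ψ w ∂(heatKernelMeasure hh hR t z r) =
      (1 - 2 * ε) * ∫ w, u w ∂(heatKernelMeasure hh hR t z s) + ε := by
    intro z
    have hUri : Integrable Ur (heatKernelMeasure hh hR t z r) :=
      hUrc.integrable_of_hasCompactSupport (HasCompactSupport.of_compactSpace Ur)
    simp only [hψ]
    rw [integral_add (hUri.const_mul _) (integrable_const _), integral_const_mul, hrep z]
    simp
  -- smooth approximants `ψ_n` with `|ψ_n - ψ| < δ_n = ε / (n + 3)`, values in `(0, 1)`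
  have hδ : ∀ n : ℕ, 0 < ε / ((n : ℝ) + 3) := fun n ↦ by have := hε.1; positivity
  choose ψn hψns hψnψ using fun n : ℕ ↦ exists_contMDiff_abs_sub_lt I hψc (hδ n)
  have hδle : ∀ n : ℕ, ε / ((n : ℝ) + 3) ≤ ε / 3 := fun n ↦ by
    apply div_le_div_of_nonneg_left hε.1.le (by norm_num)
    linarith [n.cast_nonneg (α := ℝ)]
  have hψn01 : ∀ n z, ψn n z ∈ Ioo (0 : ℝ) 1 := fun n z ↦ by
    have h1 := abs_lt.1 (hψnψ n z)
    have h2 := hψb z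
    have h3 := hδle n
    constructor <;> nlinarith [h2.1, h2.2, hε.1, hε.2]
  -- Thm. 4.1 (`T = 0`) on `[r, t]` for the propagation of `ψ_n`
  have hflow' : IsRicciFlow h cov (Icc r t) := hflow.mono (Icc_subset_Icc hr.1.le le_rfl)
  have hLip : ∀ n, ENNReal.ofReal
      |PhiInv (∫ w, ψn n w ∂(heatKernelMeasure hh hR t x r)) -
        PhiInv (∫ w, ψn n w ∂(heatKernelMeasure hh hR t y r))| ≤
      ENNReal.ofReal (1 / Real.sqrt (t - r)) * (h t).edist (hR t) x y := by
    intro n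
    have key := hflow'.ofReal_abs_PhiInv_sub_PhiInv_le hh hR hr.2 (hψns n) (hψn01 n) le_rfl
      (fun z ↦ by simp) (r := t) ⟨hr.2.le, le_rfl⟩ (by linarith) x y
    simpa only [zero_add] using key
  -- convergence of the propagations `∫ ψ_n dν_{z,t;r} → ∫ ψ dν_{z,t;r}`
  have hconv : ∀ z, Tendsto (fun n ↦ ∫ w, ψn n w ∂(heatKernelMeasure hh hR t z r)) atTop
      (𝓝 (∫ w, ψ w ∂(heatKernelMeasure hh hR t z r))) := by
    intro z
    rw [tendsto_iff_norm_sub_tendsto_zero]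
    have hbd : ∀ n, ‖∫ w, ψn n w ∂(heatKernelMeasure hh hR t z r) -
        ∫ w, ψ w ∂(heatKernelMeasure hh hR t z r)‖ ≤ ε / ((n : ℝ) + 3) := fun n ↦ by
      rw [Real.norm_eq_abs]
      exact abs_integral_heatKernelMeasure_sub_integral_le hh hR t z r
        ((hψns n).continuous.integrable_of_hasCompactSupport
          (HasCompactSupport.of_compactSpace _)) (hψi z) (fun w ↦ (hψnψ n w).le)
    have h0 : Tendsto (fun n : ℕ ↦ ε / ((n : ℝ) + 3)) atTop (𝓝 0) := by
      simpa [one_div, div_eq_mul_inv] using (tendsto_one_div_natCast_add 3).const_mul ε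
    exact squeeze_zero (fun n ↦ norm_nonneg _) hbd h0
  -- pass to the limit `n → ∞` through the continuity of `Φ⁻¹` on `(0, 1)`
  have hV01 : ∀ z, (1 - 2 * ε) * ∫ w, u w ∂(heatKernelMeasure hh hR t z s) + ε ∈
      Ioo (0 : ℝ) 1 := by
    intro z
    have hz := integral_heatKernelMeasure_mem_Icc_of_bounded hh hR t z s hum (fun w ↦ (hu01 w).1)
      (fun w ↦ (hu01 w).2)
    constructor <;> nlinarith [hz.1, hz.2, hε.1, hε.2]
  have hFconv : ∀ z, Tendsto (fun n ↦ PhiInv (∫ w, ψn n w ∂(heatKernelMeasure hh hR t z r)))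
      atTop (𝓝 (PhiInv ((1 - 2 * ε) * ∫ w, u w ∂(heatKernelMeasure hh hR t z s) + ε))) := by
    intro z
    have := hconv z
    rw [hPψ z] at this
    exact tendsto_PhiInv_comp (hV01 z).1 (hV01 z).2 this
  exact ofReal_abs_sub_le_of_tendsto (hFconv x) (hFconv y) tendsto_const_nhds
    (by positivity) hLip

/-! ### Step 2: `r ↘ s` -/

/-- **The squeezed propagations are `(t − s)^{-1/2}`-Lipschitz**: under the hypotheses of
`…_of_mem_Ioo`, `|F_ε x − F_ε y| ≤ (t − s)^{-1/2} d_{h(t)}(x, y)` (let `r ↘ s`).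
[cite: Bamler2023, §3.1, Def. 3.2 (6)] -/
theorem IsRicciFlow.ofReal_abs_PhiInv_squeeze_sub_le {s t : ℝ} (hst : s < t)
    {cov : ℝ → CovariantDerivative I (EuclideanSpace ℝ (Fin m)) (TangentSpace I : M → Type _)}
    (hflow : IsRicciFlow h cov (Icc s t))
    {u : M → ℝ} (hum : Measurable u) (hu01 : ∀ y, u y ∈ Icc (0 : ℝ) 1)
    {ε : ℝ} (hε : ε ∈ Ioo (0 : ℝ) (1 / 2)) (x y : M) :
    ENNReal.ofReal |PhiInv ((1 - 2 * ε) * ∫ z, u z ∂(heatKernelMeasure hh hR t x s) + ε) -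
        PhiInv ((1 - 2 * ε) * ∫ z, u z ∂(heatKernelMeasure hh hR t y s) + ε)| ≤
      ENNReal.ofReal (1 / Real.sqrt (t - s)) * (h t).edist (hR t) x y := by
  -- `r_n = s + (t - s)/(n + 2) ∈ (s, t)`, `r_n → s`
  set rn : ℕ → ℝ := fun n ↦ s + (t - s) / ((n : ℝ) + 2) with hrn
  have hrn_mem : ∀ n, rn n ∈ Ioo s t := fun n ↦ by
    have hts : 0 < t - s := sub_pos.2 hst
    have h2 : (2 : ℝ) ≤ (n : ℝ) + 2 := by linarith [n.cast_nonneg (α := ℝ)]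
    constructor
    · show s < s + (t - s) / ((n : ℝ) + 2)
      have : 0 < (t - s) / ((n : ℝ) + 2) := by positivity
      linarith
    · show s + (t - s) / ((n : ℝ) + 2) < t
      have : (t - s) / ((n : ℝ) + 2) < t - s := by
        rw [div_lt_iff₀ (by positivity)]
        nlinarith
      linarith
  have hrn_lim : Tendsto rn atTop (𝓝 s) := by
    have h2 := ((tendsto_one_div_natCast_add 2).const_mul (t - s)).const_add s
    simpa [hrn, one_div, div_eq_mul_inv] using h2
  have hL : Tendsto (fun n ↦ 1 / Real.sqrt (t - rn n)) atTop (𝓝 (1 / Real.sqrt (t - s))) := by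
    have h1 : Tendsto (fun n ↦ t - rn n) atTop (𝓝 (t - s)) := tendsto_const_nhds.sub hrn_lim
    simp only [one_div]
    exact h1.sqrt.inv₀ (Real.sqrt_pos.2 (sub_pos.2 hst)).ne'
  refine ofReal_abs_sub_le_of_tendsto tendsto_const_nhds tendsto_const_nhds hL (by
    have := sub_pos.2 hst; positivity) fun n ↦ ?_
  exact hflow.ofReal_abs_PhiInv_squeeze_sub_le_of_mem_Ioo hh hR hum hu01 hε (hrn_mem n) x y

/-! ### Step 3: `ε → 0` -/

/-- **Zero propagates**: on a connected `M`, if `∫ u dν_{x₀,t;s} = 0` for one `x₀` then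
`∫ u dν_{x,t;s} = 0` for all `x` (`u : M → [0, 1]` measurable, `s < t`): by Step 2,
`F_ε(x) ≤ F_ε(x₀) + (t − s)^{-1/2} d(x₀, x) = Φ⁻¹(ε) + (t − s)^{-1/2} d(x₀, x) → −∞` as `ε → 0`,
while `F_ε(x) ≥ Φ⁻¹(U(x)/2)` stays bounded if `U(x) > 0`. [cite: Bamler2023, §3.1, Def. 3.2 (6)] -/
theorem IsRicciFlow.integral_heatKernelMeasure_eq_zero_of_exists [PreconnectedSpace M] {s t : ℝ}
    (hst : s < t)
    {cov : ℝ → CovariantDerivative I (EuclideanSpace ℝ (Fin m)) (TangentSpace I : M → Type _)}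
    (hflow : IsRicciFlow h cov (Icc s t))
    {u : M → ℝ} (hum : Measurable u) (hu01 : ∀ y, u y ∈ Icc (0 : ℝ) 1)
    {x₀ : M} (hx₀ : ∫ z, u z ∂(heatKernelMeasure hh hR t x₀ s) = 0) (x : M) :
    ∫ z, u z ∂(heatKernelMeasure hh hR t x s) = 0 := by
  set U : M → ℝ := fun z ↦ ∫ w, u w ∂(heatKernelMeasure hh hR t z s) with hU
  have hUx : U x ∈ Icc (0 : ℝ) 1 :=
    integral_heatKernelMeasure_mem_Icc_of_bounded hh hR t x s hum (fun w ↦ (hu01 w).1)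
      (fun w ↦ (hu01 w).2)
  by_contra hne
  have hpos : 0 < U x := lt_of_le_of_ne hUx.1 (Ne.symm hne)
  -- finite distance and the Lipschitz bound in real form, for `ε_n = 1/(n + 4)`
  set d := (h t).edist (hR t) x₀ x with hd
  have hdt : d ≠ ⊤ := PseudoRiemannianMetric.edist_ne_top (hR t) x₀ x
  set L : ℝ := 1 / Real.sqrt (t - s) with hLdef
  have hL : 0 < L := by have := sub_pos.2 hst; positivity
  obtain ⟨εn, hεn⟩ : ∃ εn : ℕ → ℝ, εn = fun n : ℕ ↦ 1 / ((n : ℝ) + 4) := ⟨_, rfl⟩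
  have hεn_mem : ∀ n, εn n ∈ Ioo (0 : ℝ) (1 / 2) := fun n ↦ by
    rw [hεn]; exact (one_div_natCast_add_four_mem n).1
  have hεn_le : ∀ n, εn n ≤ 1 / 4 := fun n ↦ by
    rw [hεn]; exact (one_div_natCast_add_four_mem n).2
  -- upper bound: `F_ε(x) ≤ Φ⁻¹(ε) + L d`
  have hupper : ∀ n, PhiInv ((1 - 2 * εn n) * U x + εn n) ≤ PhiInv (εn n) + L * d.toReal := by
    intro n
    have key := hflow.ofReal_abs_PhiInv_squeeze_sub_le hh hR hst hum hu01 (hεn_mem n) x x₀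
    rw [PseudoRiemannianMetric.edist_comm (hR t) x x₀, ← hd, ← ENNReal.ofReal_toReal hdt,
      ← ENNReal.ofReal_mul' ENNReal.toReal_nonneg,
      ENNReal.ofReal_le_ofReal_iff (by positivity)] at key
    have hx₀' : (1 - 2 * εn n) * U x₀ + εn n = εn n := by
      show (1 - 2 * εn n) * ∫ w, u w ∂(heatKernelMeasure hh hR t x₀ s) + εn n = εn n
      rw [hx₀]; ring
    rw [hx₀'] at key
    linarith [(abs_le.1 key).2]
  -- lower bound: `Φ⁻¹(U x / 2) ≤ F_ε(x)` since `U x / 2 ≤ (1 - 2ε) U x + ε < 1`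
  have hlower : ∀ n, PhiInv (U x / 2) ≤ PhiInv ((1 - 2 * εn n) * U x + εn n) := by
    intro n
    have h1 := hεn_le n
    have h2 := (hεn_mem n).1
    have ha : 0 < U x / 2 := by linarith
    have hb1 : 1 / 2 * U x ≤ (1 - 2 * εn n) * U x :=
      mul_le_mul_of_nonneg_right (by linarith) hUx.1
    have hb : U x / 2 ≤ (1 - 2 * εn n) * U x + εn n := by linarith
    have hc1 : (1 - 2 * εn n) * U x ≤ (1 - 2 * εn n) * 1 :=
      mul_le_mul_of_nonneg_left hUx.2 (by linarith)
    have hc : (1 - 2 * εn n) * U x + εn n < 1 := by linarith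
    exact PhiInv_le_PhiInv ha hb hc
  -- `Φ⁻¹(ε_n) → -∞`: contradiction
  have hεn_lim : Tendsto εn atTop (𝓝[>] 0) := by
    refine tendsto_nhdsWithin_iff.2 ⟨?_, Eventually.of_forall fun n ↦ (hεn_mem n).1⟩
    rw [hεn]
    exact tendsto_one_div_natCast_add 4
  have hbot : Tendsto (fun n ↦ PhiInv (εn n) + L * d.toReal) atTop atBot :=
    (tendsto_PhiInv_nhdsGT_zero.comp hεn_lim).atBot_add tendsto_const_nhds
  obtain ⟨n, hn⟩ := (tendsto_atBot.1 hbot (PhiInv (U x / 2) - 1)).exists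
  linarith [hupper n, hlower n]

/-- **The value `1` propagates** likewise (apply the previous result to `1 − u`).
[cite: Bamler2023, §3.1, Def. 3.2 (6)] -/
theorem IsRicciFlow.integral_heatKernelMeasure_eq_one_of_exists [PreconnectedSpace M] {s t : ℝ}
    (hst : s < t)
    {cov : ℝ → CovariantDerivative I (EuclideanSpace ℝ (Fin m)) (TangentSpace I : M → Type _)}
    (hflow : IsRicciFlow h cov (Icc s t))
    {u : M → ℝ} (hum : Measurable u) (hu01 : ∀ y, u y ∈ Icc (0 : ℝ) 1)
    {x₀ : M} (hx₀ : ∫ z, u z ∂(heatKernelMeasure hh hR t x₀ s) = 1) (x : M) :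
    ∫ z, u z ∂(heatKernelMeasure hh hR t x s) = 1 := by
  have hub : ∀ z, |u z| ≤ 1 := fun z ↦ abs_le.2 ⟨by linarith [(hu01 z).1], (hu01 z).2⟩
  have hum' : Measurable fun z ↦ 1 - u z := measurable_const.sub hum
  have hu01' : ∀ y, 1 - u y ∈ Icc (0 : ℝ) 1 := fun y ↦
    ⟨by linarith [(hu01 y).2], by linarith [(hu01 y).1]⟩
  have hsub : ∀ z, ∫ w, (1 - u w) ∂(heatKernelMeasure hh hR t z s) =
      1 - ∫ w, u w ∂(heatKernelMeasure hh hR t z s) := by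
    intro z
    rw [integral_sub (integrable_const _)
      (integrable_heatKernelMeasure_of_bounded hh hR t z s hum hub)]
    simp
  have h0 : ∫ w, (1 - u w) ∂(heatKernelMeasure hh hR t x₀ s) = 0 := by rw [hsub, hx₀, sub_self]
  have key := hflow.integral_heatKernelMeasure_eq_zero_of_exists hh hR hst hum' hu01' h0 x
  rw [hsub] at key
  linarith

/-- **Bamler 2023, Def. 3.2 (6) with `T = 0` for the heat kernel measures of a Ricci flow.**
Let `h` be a `C^∞` family of Riemannian metrics on the closed connected manifold `M` which is a
Ricci flow on `[s, t]`, `s < t`, and `u : M → [0, 1]` measurable. Then the function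
`x ↦ ∫ u dν_{x,t;s}` is either constant, or equal to `Φ ∘ f'` for an `f'` which is
`(t − s)^{-1/2}`-Lipschitz for the Riemannian distance of `h(t)`:
`|f' x − f' y| ≤ (t − s)^{-1/2} d_{h(t)}(x, y)`. [cite: Bamler2023, §3.1, Def. 3.2 (6)] -/
theorem IsRicciFlow.integral_heatKernelMeasure_const_or_eq_Phi [PreconnectedSpace M] {s t : ℝ}
    (hst : s < t)
    {cov : ℝ → CovariantDerivative I (EuclideanSpace ℝ (Fin m)) (TangentSpace I : M → Type _)}
    (hflow : IsRicciFlow h cov (Icc s t))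
    {u : M → ℝ} (hum : Measurable u) (hu01 : ∀ y, u y ∈ Icc (0 : ℝ) 1) :
    (∃ c : ℝ, ∀ x, ∫ z, u z ∂(heatKernelMeasure hh hR t x s) = c) ∨
      ∃ f' : M → ℝ,
        (∀ x y, ENNReal.ofReal |f' x - f' y| ≤
          ENNReal.ofReal (1 / Real.sqrt (t - s)) * (h t).edist (hR t) x y) ∧
        ∀ x, ∫ z, u z ∂(heatKernelMeasure hh hR t x s) = Phi (f' x) := by
  set U : M → ℝ := fun z ↦ ∫ w, u w ∂(heatKernelMeasure hh hR t z s) with hU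
  have hU01 : ∀ z, U z ∈ Icc (0 : ℝ) 1 := fun z ↦
    integral_heatKernelMeasure_mem_Icc_of_bounded hh hR t z s hum (fun w ↦ (hu01 w).1)
      (fun w ↦ (hu01 w).2)
  by_cases h0 : ∃ x₀, U x₀ = 0
  · obtain ⟨x₀, hx₀⟩ := h0
    exact Or.inl ⟨0, fun x ↦
      hflow.integral_heatKernelMeasure_eq_zero_of_exists hh hR hst hum hu01 hx₀ x⟩
  by_cases h1 : ∃ x₀, U x₀ = 1
  · obtain ⟨x₀, hx₀⟩ := h1
    exact Or.inl ⟨1, fun x ↦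
      hflow.integral_heatKernelMeasure_eq_one_of_exists hh hR hst hum hu01 hx₀ x⟩
  push Not at h0 h1
  have hUoo : ∀ z, U z ∈ Ioo (0 : ℝ) 1 := fun z ↦
    ⟨lt_of_le_of_ne (hU01 z).1 (Ne.symm (h0 z)), lt_of_le_of_ne (hU01 z).2 (h1 z)⟩
  refine Or.inr ⟨fun z ↦ PhiInv (U z), fun x y ↦ ?_, fun x ↦ (Phi_PhiInv (hUoo x).1 (hUoo x).2).symm⟩
  -- `ε_n = 1/(n + 4) → 0`: `F_{ε_n}(z) → Φ⁻¹ (U z)`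
  obtain ⟨εn, hεn⟩ : ∃ εn : ℕ → ℝ, εn = fun n : ℕ ↦ 1 / ((n : ℝ) + 4) := ⟨_, rfl⟩
  have hεn_mem : ∀ n, εn n ∈ Ioo (0 : ℝ) (1 / 2) := fun n ↦ by
    rw [hεn]; exact (one_div_natCast_add_four_mem n).1
  have hεn_lim : Tendsto εn atTop (𝓝 0) := by
    rw [hεn]; exact tendsto_one_div_natCast_add 4
  have hconv : ∀ z, Tendsto (fun n ↦ PhiInv ((1 - 2 * εn n) * U z + εn n)) atTop
      (𝓝 (PhiInv (U z))) := by
    intro z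
    refine tendsto_PhiInv_comp (hUoo z).1 (hUoo z).2 ?_
    have : Tendsto (fun n ↦ (1 - 2 * εn n) * U z + εn n) atTop
        (𝓝 ((1 - 2 * 0) * U z + 0)) :=
      ((tendsto_const_nhds.sub (hεn_lim.const_mul 2)).mul_const _).add hεn_lim
    simpa using this
  exact ofReal_abs_sub_le_of_tendsto (hconv x) (hconv y) tendsto_const_nhds
    (by have := sub_pos.2 hst; positivity)
    fun n ↦ hflow.ofReal_abs_PhiInv_squeeze_sub_le hh hR hst hum hu01 (hεn_mem n) x y

end GradientZero

end Literature.Geometry.Riemannian
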